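/-
COR-CM (cell pub-hodgecm2, stage 2 of the Hodge ladder) — count-neutral KERNEL COMBINATORICS «dicyclic twist: the type-stabiliser subgroup and the
floor for EVERY finite abelian A» (seat prover-pub-hodgecm2-b23-g43-0, binder prover b23, gen 43; claim DICYCLIC-EVEN, HOME/INBOX.md l.10881;
blanket `Census/DicyclicTwist*`, lead l.10330).  Theorems only (no definition), on top of the dictionary of the lane (`Census/DicyclicTwistDictionary.lean`,
`Census/DicyclicTwistPlaces.lean`, `Census/DicyclicTwistBlockCount.lean`, gen 42), the census seat lit-andre-3's type-stabiliser subgroup and closed form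
(`Census/TypeStabiliserSubgroup.lean`, `Census/TypeStabiliserIndexTwoRank.lean`, `Census/TypeStabiliserCharK.lean`) and seat b09's coinvariant floor
(`Census/CoinvariantFloor.lean`), all used BY NAME; no `decide` beyond closed identities in `ZMod 2`, no certificate, no named fact, no `sorry`.
`Interfaces.lean` (C1), every E term, B01, `Transposition/*`, `PortJoin/*` untouched.
HONEST FRAMING: `HC_CM` is NOT proved, here or anywhere in the tree; nothing here is a period, a count of record or a headline.
T5: n/a-class (the only hypothesis binders are the fields of the dicyclic datum and `c * c = 1`); checker: self, 2026-08-23.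
-/
import Summits.HodgeConjecture.CorCM.Census.DicyclicTwistBlockCount
import Summits.HodgeConjecture.CorCM.Census.TypeStabiliserCharK
import Summits.HodgeConjecture.CorCM.Census.CoinvariantFloor

/-!
# The dicyclic twist: `𝒦(G, c) = ℤ/2 × A` along every dicyclic datum, `d₂(G/𝒦) = 1`, `φ₂(G, c) = β(G, c) − 1`, and the floor `μ ≥ β − 1`
# for EVERY finite abelian `A`

Let `(G, c)` carry a dicyclic datum `D : Datum G c A` over a finite abelian group `A` (`G ≅ Dic(ℤ/2 × A, c)`: an embedded
`ι : ℤ/2 × A ↪ G` with `ι(1,0) = c`, a twisting element `x` with `x·ι a = ι(−a)·x`, `x² = c`, the two cosets exhausting `G`).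
Part `Census/DicyclicTwistTransport.lean` (gen 42) obtained the floor `β(G,c) ≤ |S| + 1` for `|A|` ODD from seat b09's block parities, the
defect `wdelta` vanishing because the twisting element has `x^{|G|/2} = c^{|A|} = c ≠ 1`.  For `|A|` EVEN every element of `G` has
`g^{|G|/2} = 1` and that transfer is silent.  This file gives the floor for EVERY `A` from the census seat lit-andre-3's closed form of the
coinvariant fibre, `φ₂(G,c) + 1 + [|G|/2 even] = β(G,c) + d₂(G/𝒦)` (`TypeStabiliser.fibreTwo_add_eq_card_block_add_indexTwoRank`), by
computing the type-stabiliser subgroup `𝒦(G, c) = ⟨c, {g | c ∉ ⟨g⟩}⟩` along the datum: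

* §1 `(ιHom D).range = ι(ℤ/2 × A)` as a subgroup; it has index two (`index_ιRange`), the elements `x·ι a` lie outside it.
* §2 **`stabGen c = (ιHom D).range`** (`stabGen_eq_ιRange`): every `x·ι a` squares to `c`, so `c ∈ ⟨x·ι a⟩` and no element of the odd coset is
  a generator of `𝒦`; conversely `ι(0, s)` never has `c = ι(1,0)` among its powers (first coordinate), so `ι(0,s) ∈ 𝒦`, and `c ∈ 𝒦`.
* §3 **`d₂(G/𝒦) = 1`** (`indexTwoRank_stabGen_eq_one`): the only index-two subgroup over `(ιHom D).range` is itself.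
* §4 **`φ₂(G, c) + 1 = β(G, c)`** (`fibreTwo_add_one_eq_card_block`; `|G|/2 = 2|A|` is even).
* §5 **THE FLOOR FOR EVERY `A`** (`card_block_le_card_add_one_of_subset_hodgeSpan`): for every finite family `S` of integer Hodge vectors
  whose base changes together with the pairs generate the abstract faces, `β(G, c) ≤ |S| + 1` (seat b09's `Coinvariant.fibreTwo_le_card`);
  in particular for families of abstract rank-four faces (`card_block_le_card_add_one_of_subset_gfaceSet`), and the `IsLeast` packaging
  `le_of_mem_generating` used by the law files.  For `|A|` odd this recovers gen 42's `card_block_le_card_add_one` (there for arbitrary `S`).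

All [folklore] (Pohlmann's dictionary [Pohlmann1968, Thm 1]; the group theory is elementary).

## References
* [Pohlmann1968] H. Pohlmann, Algebraic cycles on abelian varieties of complex multiplication type, Ann. of Math. 88 (1968), Thm 1.
* [Milne1999] J. S. Milne, Lefschetz motives and the Tate conjecture, Compositio Math. 117 (1999), Prop. 2.1, p. 54.
-/

namespace Summit.HodgeConjecture.CorCM.Census.DicyclicTwist

open Finset
open Summit.HodgeConjecture.CorCM.Prior.AllgGroup.RfwfAllgGroup
open Summit.HodgeConjecture.CorCM.Census.BlockParity
open Summit.HodgeConjecture.CorCM.Census.Coinvariant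
open Summit.HodgeConjecture.CorCM.Census.TypeStabiliser
open Summit.HodgeConjecture.CorCM.Census.IndexTwo

noncomputable section

variable {G : Type*} [Group G] [Fintype G] [DecidableEq G] {c : G}
variable {A : Type} [AddCommGroup A] [Fintype A] [DecidableEq A]
variable (D : Datum G c A)

/-! ## §1 The index-two subgroup `ι(ℤ/2 × A)` -/

omit [Fintype G] [DecidableEq G] [Fintype A] [DecidableEq A] in
/-- Membership in `ι(ℤ/2 × A)`. [folklore] -/
theorem mem_ιRange_iff (g : G) : g ∈ (ιHom D).range ↔ ∃ a, D.ι a = g := by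
  constructor
  · rintro ⟨a, rfl⟩
    exact ⟨a.toAdd, rfl⟩
  · rintro ⟨a, rfl⟩
    exact ⟨Multiplicative.ofAdd a, rfl⟩

omit [Fintype G] [DecidableEq G] [Fintype A] [DecidableEq A] in
/-- `ι a ∈ ι(ℤ/2 × A)`. [folklore] -/
theorem ι_mem_ιRange (a : ZMod 2 × A) : D.ι a ∈ (ιHom D).range := (mem_ιRange_iff D _).mpr ⟨a, rfl⟩

omit [Fintype G] [DecidableEq G] [Fintype A] [DecidableEq A] in
/-- `c ∈ ι(ℤ/2 × A)`. [folklore] -/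
theorem c_mem_ιRange : c ∈ (ιHom D).range := (mem_ιRange_iff D c).mpr ⟨(1, 0), D.map_c⟩

omit [Fintype G] [DecidableEq G] [Fintype A] [DecidableEq A] in
/-- `x·ι a ∉ ι(ℤ/2 × A)`. [folklore] -/
theorem xι_notMem_ιRange (a : ZMod 2 × A) : D.x * D.ι a ∉ (ιHom D).range := by
  rintro h
  obtain ⟨b, hb⟩ := (mem_ιRange_iff D _).mp h
  exact ι_ne_xι D b a hb

omit [Fintype G] [DecidableEq G] [Fintype A] [DecidableEq A] in
/-- `x ∉ ι(ℤ/2 × A)`. [folklore] -/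
theorem x_notMem_ιRange : D.x ∉ (ιHom D).range := by
  have h := xι_notMem_ιRange D 0
  rwa [ι_zero, mul_one] at h

omit [Fintype G] [DecidableEq G] [Fintype A] [DecidableEq A] in
/-- **`ι(ℤ/2 × A)` has index two.** [folklore] -/
theorem index_ιRange : ((ιHom D).range).index = 2 := by
  refine Subgroup.index_eq_two_iff.mpr ⟨D.x, fun b => ?_⟩
  obtain ⟨a, rfl | rfl⟩ := D.exhaust b
  · refine Or.inr ⟨ι_mem_ιRange D a, ?_⟩
    rw [ι_mul_x]
    exact xι_notMem_ιRange D (-a)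
  · refine Or.inl ⟨?_, xι_notMem_ιRange D a⟩
    rw [mul_assoc, ι_mul_x, ← mul_assoc, D.x_mul_x, c_mul_ι]
    exact ι_mem_ιRange D _

/-! ## §2 The type-stabiliser subgroup along the datum -/

omit [Fintype G] [DecidableEq G] [Fintype A] [DecidableEq A] in
/-- `c ∉ ⟨ι(0, s)⟩`: every power of `ι(0,s)` has first coordinate `0`. [folklore] -/
theorem c_notMem_zpowers_ι_zero (s : A) : c ∉ Subgroup.zpowers (D.ι (0, s)) := by
  intro h
  obtain ⟨k, hk⟩ := Subgroup.mem_zpowers_iff.mp h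
  rw [ι_zpow] at hk
  have h1 : (k • (((0 : ZMod 2), s) : ZMod 2 × A)).1 = (((1 : ZMod 2), (0 : A)) : ZMod 2 × A).1 :=
    congrArg Prod.fst (D.inj (hk.trans D.map_c.symm))
  simp only [Prod.smul_fst, smul_zero] at h1
  exact zero_ne_one h1

omit [Fintype G] [DecidableEq G] [Fintype A] [DecidableEq A] in
/-- `ι(0, s) ∈ 𝒦`. [folklore] -/
theorem ι_zero_mem_stabGen (s : A) : D.ι (0, s) ∈ stabGen c :=
  mem_stabGen_of_notMem_zpowers c (c_notMem_zpowers_ι_zero D s)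

omit [Fintype G] [DecidableEq G] [Fintype A] [DecidableEq A] in
/-- `ι(e, s) ∈ 𝒦` for every `(e, s)` (`ι(e,s) = ι(e,0)·ι(0,s)` with `ι(1,0) = c`). [folklore] -/
theorem ι_mem_stabGen (a : ZMod 2 × A) : D.ι a ∈ stabGen c := by
  obtain ⟨e, s⟩ := a
  have hsplit : D.ι (e, s) = D.ι (e, 0) * D.ι (0, s) := by
    rw [← D.map_add, Prod.mk_add_mk, add_zero, zero_add]
  rw [hsplit]
  refine Subgroup.mul_mem _ ?_ (ι_zero_mem_stabGen D s)
  have h01 : ∀ u : ZMod 2, u = 0 ∨ u = 1 := by decide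
  rcases h01 e with rfl | rfl
  · rw [show ((0 : ZMod 2), (0 : A)) = (0 : ZMod 2 × A) from rfl, ι_zero]
    exact Subgroup.one_mem _
  · rw [D.map_c]
    exact self_mem_stabGen c

omit [Fintype G] [DecidableEq G] [Fintype A] [DecidableEq A] in
/-- **`𝒦(G, c) = ι(ℤ/2 × A)` along every dicyclic datum.** [folklore] -/
theorem stabGen_eq_ιRange : stabGen c = (ιHom D).range := by
  refine le_antisymm ?_ ?_
  · refine (stabGen_le_iff_subset c).mpr ⟨c_mem_ιRange D, fun g hg => ?_⟩
    obtain ⟨a, rfl | rfl⟩ := D.exhaust g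
    · exact ι_mem_ιRange D a
    · exact absurd (c_mem_zpowers_xι D a) hg
  · rintro g hg
    obtain ⟨a, rfl⟩ := (mem_ιRange_iff D g).mp hg
    exact ι_mem_stabGen D a

omit [Fintype G] [DecidableEq G] [Fintype A] [DecidableEq A] in
include D in
/-- `𝒦(G, c)` has index two. [folklore] -/
theorem index_stabGen : (stabGen c).index = 2 := by
  rw [stabGen_eq_ιRange D]; exact index_ιRange D

/-! ## §3 `d₂(G/𝒦) = 1` -/

omit [DecidableEq G] [Fintype A] [DecidableEq A] in
include D in
/-- An index-two subgroup over `𝒦` is `𝒦`. [folklore] -/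
theorem eq_stabGen_of_le {H : Subgroup G} (hH : H.index = 2) (hle : stabGen c ≤ H) : H = stabGen c := by
  symm
  refine Subgroup.eq_of_le_of_card_ge hle (le_of_eq ?_)
  have h1 := (stabGen c).index_mul_card
  have h2 := H.index_mul_card
  rw [index_stabGen D] at h1
  rw [hH] at h2
  omega

omit [DecidableEq G] [Fintype A] [DecidableEq A] in
include D in
/-- Exactly one index-two subgroup lies over `𝒦`. [folklore] -/
theorem card_indexTwoOver_stabGen : Nat.card {H : Subgroup G // H.index = 2 ∧ stabGen c ≤ H} = 1 := by
  rw [Nat.card_eq_one_iff_unique]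
  refine ⟨⟨fun H K => Subtype.ext ((eq_stabGen_of_le D H.2.1 H.2.2).trans (eq_stabGen_of_le D K.2.1 K.2.2).symm)⟩,
    ⟨⟨stabGen c, index_stabGen D, le_rfl⟩⟩⟩

omit [DecidableEq G] [Fintype A] [DecidableEq A] in
include D in
/-- **`d₂(G/𝒦) = 1` along every dicyclic datum.** [folklore] -/
theorem indexTwoRank_stabGen_eq_one : indexTwoRank (stabGen c) = 1 := by
  have h := two_pow_indexTwoRank_stabGen c (mul_c_comm D)
  rw [card_indexTwoOver_stabGen D] at h
  exact Nat.pow_right_injective (le_refl 2) (by simpa using h)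

/-! ## §4 `φ₂(G, c) = β(G, c) − 1` -/

omit [DecidableEq G] [DecidableEq A] in
include D in
/-- `|G|/2 = 2|A|` is even. [folklore] -/
theorem even_card_div_two : Even (Fintype.card G / 2) :=
  ⟨Fintype.card A, by rw [card_eq_four_mul D]; omega⟩

omit [DecidableEq A] in
include D in
/-- **`φ₂(G, c) + 1 = β(G, c)` along every dicyclic datum** (any finite abelian `A`). [folklore] -/
theorem fibreTwo_add_one_eq_card_block (hc2 : c * c = 1) : fibreTwo c hc2 + 1 = Fintype.card (BlockParity.Block c) := by
  -- `c ≠ 1` along the datum: `ι (1,0) = c`, `ι 0 = 1`, `ι` injective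
  have hc1 : c ≠ 1 := fun h => by
    have h1 : D.ι (1, 0) = D.ι 0 := D.map_c.trans (h.trans (ι_zero D).symm)
    have h3 : (1 : ZMod 2) = 0 := congrArg Prod.fst (D.inj h1)
    exact absurd h3 (by decide)
  have h := fibreTwo_add_two_eq_card_block_add_indexTwoRank c hc2 hc1 (mul_c_comm D) (even_card_div_two D)
  rw [indexTwoRank_stabGen_eq_one D] at h
  omega

/-! ## §5 The floor for every `A` -/

omit [DecidableEq A] in
include D in
/-- **FLOOR (every finite abelian `A`): `β(G, c) ≤ |S| + 1`** for every finite family `S` of integer Hodge vectors whose base changes, together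
with the pairs, generate the abstract faces (seat b09's coinvariant floor `|S| ≥ φ₂` and §4). [folklore] -/
theorem card_block_le_card_add_one_of_subset_hodgeSpan (hc2 : c * c = 1) (S : Finset (CMF G c →₀ ℤ))
    (hSH : (S : Set (CMF G c →₀ ℤ)) ⊆ hodgeSpan c hc2)
    (hS : gfaceSet G c hc2 ⊆ ↑(Submodule.span ℤ (pairSet c) ⊔ Submodule.span ℤ (translates c S))) :
    Fintype.card (BlockParity.Block c) ≤ S.card + 1 := by
  have h := fibreTwo_le_card c hc2 (mul_c_comm D) S (Submodule.span ℤ (pairSet c)) le_rfl hSH hS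
  have h1 := fibreTwo_add_one_eq_card_block D hc2
  omega

omit [DecidableEq A] in
include D in
/-- **FLOOR for families of abstract rank-four faces**: `S ⊆ gfaceSet`, `hodgeSpan ≤ ℤ⟨pairs⟩ ⊔ ℤ⟨translates S⟩ ⇒ β(G, c) ≤ |S| + 1`. [folklore] -/
theorem card_block_le_card_add_one_of_subset_gfaceSet (hc2 : c * c = 1) (S : Finset (CMF G c →₀ ℤ))
    (hSF : (S : Set (CMF G c →₀ ℤ)) ⊆ gfaceSet G c hc2)
    (hgen : hodgeSpan c hc2 ≤ Submodule.span ℤ (pairSet c) ⊔ Submodule.span ℤ (translates c S)) :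
    Fintype.card (BlockParity.Block c) ≤ S.card + 1 :=
  card_block_le_card_add_one_of_subset_hodgeSpan D hc2 S (fun _ hy => gfaceSet_subset_hodgeSpan c hc2 (hSF hy))
    (fun _ hy => hgen (gfaceSet_subset_hodgeSpan c hc2 hy))

omit [DecidableEq A] in
include D in
/-- **Lower-bound half of the law, every `A`**: every member of `{|S| : S ⊆ gfaceSet generating}` is `≥ β(G, c) − 1`. [folklore] -/
theorem le_of_mem_generating (hc2 : c * c = 1) :
    Fintype.card (BlockParity.Block c) - 1 ∈ lowerBounds {m : ℕ | ∃ S : Finset (CMF G c →₀ ℤ), ↑S ⊆ gfaceSet G c hc2 ∧ S.card = m ∧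
      hodgeSpan c hc2 ≤ Submodule.span ℤ (pairSet c) ⊔ Submodule.span ℤ (translates c S)} := by
  rintro m ⟨S, hSF, rfl, hgen⟩
  have h := card_block_le_card_add_one_of_subset_gfaceSet D hc2 S hSF hgen
  omega

end

end Summit.HodgeConjecture.CorCM.Census.DicyclicTwist
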